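import Literature.NumberTheory.Automorphic.BrandtModuleProofs
import Literature.NumberTheory.Automorphic.BrandtModuleResidueRamifiedCubic
import HarnessLib

/-!
# Residual structure of Eichler orders at primes not dividing the level

Thirteenth layer of the proof files for the named fact `brandtMatrix_comm` of `BrandtModule.lean`
(Vignéras, LNM 800, III §5 ex. 5.8; Eichler 1973, II §6 Thm. 2). An Eichler order
`O = O₁ ∩ O₂` of level `N` (`[O₁ : O] = N`) agrees with the maximal order `O₁` at every prime
`p ∤ N`: `p O₁ ∩ O = p O` and `O → O₁ / p O₁` is onto, so `O / p O ≅ O₁ / p O₁`. We transfer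
the residual dichotomy of `BrandtModuleResidueRamifiedCubic.lean` along this isomorphism:

* `mem_smul_of_mem_smul_of_coprime` (`p O₁ ∩ O = p O`), `exists_mem_sub_mem_smul`
  (surjectivity), `IsZOrder.IsResiduallySplit.of_le`, `IsZOrder.IsResiduallyRamified.of_le`;
* `IsEichlerOrder.residuallySplit_or_ramified` — an Eichler order of level `N` is residually
  split or residually ramified at every prime `p ∤ N`.

## References

* M.-F. Vignéras, *Arithmétique des algèbres de quaternions*, LNM 800 (1980), Ch. I §4
  (ordres d'Eichler), Ch. II §§1–2, Ch. III §5 (propriétés locales–globales) [VignerasLNM800].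
-/

noncomputable section

open scoped Pointwise

universe u

namespace Literature.NumberTheory.Automorphic

variable {B : Type u} [Ring B] [Algebra ℚ B] [IsQuaternionAlgebra ℚ B]

section Transfer

variable {O O₁ : Submodule ℤ B} {N p : ℕ}

omit [Algebra ℚ B] [IsQuaternionAlgebra ℚ B] in
/-- `N • x ∈ O` for `x ∈ O₁` when `[O₁ : O] = N`. [folklore] -/
theorem natCast_smul_mem_of_relIndex (hN : O.toAddSubgroup.relIndex O₁.toAddSubgroup = N) {x : B}
    (hx : x ∈ O₁) : (N : ℤ) • x ∈ O := by
  rw [← hN]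
  exact zsmul_relIndex_mem hx

omit [Algebra ℚ B] [IsQuaternionAlgebra ℚ B] in
/-- **`p O₁ ∩ O = p O`** for `[O₁ : O] = N` coprime to `p`: if `x = p y ∈ O` with `y ∈ O₁` then
`y = a p y + b N y ∈ O`. [folklore] -/
theorem mem_smul_of_mem_smul_of_coprime (hN : O.toAddSubgroup.relIndex O₁.toAddSubgroup = N)
    (hpN : p.Coprime N) {x : B} (hx : x ∈ O) (hx₁ : x ∈ (p : ℤ) • O₁) : x ∈ (p : ℤ) • O := by
  obtain ⟨y, hy, rfl⟩ := (Submodule.mem_smul_pointwise_iff_exists _ _ O₁).mp hx₁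
  obtain ⟨a, b, hab⟩ := Nat.isCoprime_iff_coprime.mpr hpN
  refine Submodule.smul_mem_pointwise_smul _ _ O ?_
  have : y = a • ((p : ℤ) • y) + b • ((N : ℤ) • y) := by
    rw [smul_smul, smul_smul, ← add_smul, hab, one_smul]
  rw [this]
  exact O.add_mem (O.smul_mem _ hx) (O.smul_mem _ (natCast_smul_mem_of_relIndex hN hy))

omit [Algebra ℚ B] [IsQuaternionAlgebra ℚ B] in
/-- **`O → O₁ / p O₁` is onto** for `[O₁ : O] = N` coprime to `p`: `x = b N x₁ ∈ O` has
`x − x₁ = −a p x₁`. [folklore] -/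
theorem exists_mem_sub_mem_smul (hN : O.toAddSubgroup.relIndex O₁.toAddSubgroup = N)
    (hpN : p.Coprime N) {x₁ : B} (hx₁ : x₁ ∈ O₁) : ∃ x ∈ O, x - x₁ ∈ (p : ℤ) • O₁ := by
  obtain ⟨a, b, hab⟩ := Nat.isCoprime_iff_coprime.mpr hpN
  refine ⟨b • ((N : ℤ) • x₁), O.smul_mem _ (natCast_smul_mem_of_relIndex hN hx₁), ?_⟩
  have : b • ((N : ℤ) • x₁) - x₁ = (p : ℤ) • ((-a) • x₁) := by
    rw [smul_smul, smul_smul, show (p : ℤ) * -a = b * (N : ℤ) - 1 by linear_combination -hab,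
      sub_smul, one_smul]
  rw [this]
  exact Submodule.smul_mem_pointwise_smul _ _ O₁ (O₁.smul_mem _ hx₁)

omit [Algebra ℚ B] [IsQuaternionAlgebra ℚ B] in
/-- Products of congruent elements are congruent modulo `m O₁`. [folklore] -/
theorem IsZOrder.mul_sub_mul_mem_smul (hO₁ : IsZOrder O₁) {m : ℤ} {x x' y y' : B} (hx' : x' ∈ O₁)
    (hy : y ∈ O₁) (hxx : x - x' ∈ m • O₁) (hyy : y - y' ∈ m • O₁) : x * y - x' * y' ∈ m • O₁ := by
  have : x * y - x' * y' = (x - x') * y + x' * (y - y') := by noncomm_ring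
  rw [this]
  exact Submodule.add_mem _ (hO₁.smul_mul_mem hxx hy) (hO₁.mul_smul_mem hx' hyy)

omit [Algebra ℚ B] [IsQuaternionAlgebra ℚ B] in
/-- **Residual splitness descends** from `O₁` to `O ≤ O₁` with `[O₁ : O] = N` coprime to `p`
(replace the matrix units by congruent elements of `O`; relations modulo `p O₁` between elements
of `O` hold modulo `p O₁ ∩ O = p O`). [cite: VignerasLNM800, Ch. II §2 Thm. 2.3; Ch. III §5] -/
theorem IsZOrder.IsResiduallySplit.of_le (hO : IsZOrder O) (hO₁ : IsZOrder O₁) (hle : O ≤ O₁)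
    (hN : O.toAddSubgroup.relIndex O₁.toAddSubgroup = N) (hpN : p.Coprime N)
    (h : hO₁.IsResiduallySplit p) : hO.IsResiduallySplit p := by
  obtain ⟨e₁, u₁, v₁, he₁, hu₁, hv₁, r1, r2, r3, r4, r5, r6, r7, r8, r9, hspan⟩ := h
  obtain ⟨e, he, hee⟩ := exists_mem_sub_mem_smul hN hpN he₁
  obtain ⟨u, hu, huu⟩ := exists_mem_sub_mem_smul hN hpN hu₁
  obtain ⟨v, hv, hvv⟩ := exists_mem_sub_mem_smul hN hpN hv₁
  have key : ∀ {z : B}, z ∈ O → z ∈ (p : ℤ) • O₁ → z ∈ (p : ℤ) • O := fun hz hz₁ =>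
    mem_smul_of_mem_smul_of_coprime hN hpN hz hz₁
  have hpO₁ : ∀ {z : B}, z ∈ (p : ℤ) • O → z ∈ (p : ℤ) • O₁ := fun hz => by
    obtain ⟨o, ho, rfl⟩ := (Submodule.mem_smul_pointwise_iff_exists _ _ O).mp hz
    exact Submodule.smul_mem_pointwise_smul _ _ O₁ (hle ho)
  -- transfer of a relation `x y − z ≡ 0`
  have rel : ∀ {x x' y y' z z' : B}, x ∈ O → y ∈ O → z ∈ O → x' ∈ O₁ → y' ∈ O₁ →
      x - x' ∈ (p : ℤ) • O₁ → y - y' ∈ (p : ℤ) • O₁ → z - z' ∈ (p : ℤ) • O₁ →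
      x' * y' - z' ∈ (p : ℤ) • O₁ → x * y - z ∈ (p : ℤ) • O := by
    intro x x' y y' z z' hx hy hz hx' _ hxx hyy hzz hrel
    refine key (O.sub_mem (hO.mul_mem _ hx _ hy) hz) ?_
    have : x * y - z = (x * y - x' * y') + (x' * y' - z') - (z - z') := by abel
    rw [this]
    exact Submodule.sub_mem _ (Submodule.add_mem _
      (hO₁.mul_sub_mul_mem_smul hx' (hle hy) hxx hyy) hrel) hzz
  have rel0 : ∀ {x x' y y' : B}, x ∈ O → y ∈ O → x' ∈ O₁ → y' ∈ O₁ →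
      x - x' ∈ (p : ℤ) • O₁ → y - y' ∈ (p : ℤ) • O₁ → x' * y' ∈ (p : ℤ) • O₁ → x * y ∈ (p : ℤ) • O := by
    intro x x' y y' hx hy hx' hy' hxx hyy hrel
    simpa using rel (z := 0) (z' := 0) hx hy O.zero_mem hx' hy' hxx hyy (by simp) (by simpa using hrel)
  have h0 : (0 : B) - 0 ∈ (p : ℤ) • O₁ := by simp
  have h1e : (1 - e) - (1 - e₁) ∈ (p : ℤ) • O₁ := by
    have : (1 - e) - (1 - e₁) = -(e - e₁) := by abel
    rw [this]; exact Submodule.neg_mem _ hee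
  refine ⟨e, u, v, he, hu, hv, rel he he he he₁ he₁ hee hee hee r1, rel he hu hu he₁ hu₁ hee huu huu r2,
    rel0 hu he hu₁ he₁ huu hee r3, rel0 hu hu hu₁ hu₁ huu huu r4, rel0 hv hv hv₁ hv₁ hvv hvv r5,
    rel0 he hv he₁ hv₁ hee hvv r6, rel hv he hv hv₁ he₁ hvv hee hvv r7, rel hu hv he hu₁ hv₁ huu hvv hee r8,
    rel hv hu (O.sub_mem hO.one_mem he) hv₁ hu₁ hvv huu h1e r9, fun x hx => ?_⟩
  obtain ⟨a, b, c, d, habcd⟩ := hspan x (hle hx)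
  refine ⟨a, b, c, d, key (O.sub_mem hx (O.add_mem (O.add_mem (O.add_mem (O.smul_mem _ he)
    (O.smul_mem _ hu)) (O.smul_mem _ hv)) (O.smul_mem _ (O.sub_mem hO.one_mem he)))) ?_⟩
  have : x - (a • e + b • u + c • v + d • (1 - e)) = (x - (a • e₁ + b • u₁ + c • v₁ + d • (1 - e₁)))
      - (a • (e - e₁) + b • (u - u₁) + c • (v - v₁) + d • ((1 - e) - (1 - e₁))) := by
    simp only [smul_sub]; abel
  rw [this]
  exact Submodule.sub_mem _ habcd (Submodule.add_mem _ (Submodule.add_mem _ (Submodule.add_mem _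
    (Submodule.smul_mem _ _ hee) (Submodule.smul_mem _ _ huu)) (Submodule.smul_mem _ _ hvv))
    (Submodule.smul_mem _ _ h1e))

/-- **Residual ramification descends** from `O₁` to `O ≤ O₁` with `[O₁ : O] = N` coprime to
`p`, with `𝔓_O = 𝔓 ∩ O`: `𝔓_O² ⊆ p O₁ ∩ O = p O` and `p O ⊆ 𝔓_O²` (as `(cN)² ≡ 1 (mod p)` and
`(cN)² 𝔓² ⊆ 𝔓_O²`), `[O : 𝔓_O] = [O₁ : 𝔓] = p²` by an index count, and invertibility modulo
`𝔓_O` by moving inverses into `O`. [cite: VignerasLNM800, Ch. II §1 Thm. 1.1; Ch. III §5] -/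
theorem IsZOrder.IsResiduallyRamified.of_le (hO : IsZOrder O) (hO₁ : IsZOrder O₁) (hle : O ≤ O₁)
    (hN : O.toAddSubgroup.relIndex O₁.toAddSubgroup = N) (hpN : p.Coprime N) (hp : p.Prime)
    (h : hO₁.IsResiduallyRamified p) : hO.IsResiduallyRamified p := by
  obtain ⟨P, hlow, hup, hOP, hPO, hPP, hidx, hdiv⟩ := h
  obtain ⟨a, b, hab⟩ := Nat.isCoprime_iff_coprime.mpr hpN
  have hN0 : N ≠ 0 := by
    rintro rfl
    exact hp.one_lt.ne' (Nat.Coprime.eq_one_of_dvd hpN (dvd_zero p))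
  have key : ∀ {z : B}, z ∈ O → z ∈ (p : ℤ) • O₁ → z ∈ (p : ℤ) • O := fun hz hz₁ =>
    mem_smul_of_mem_smul_of_coprime hN hpN hz hz₁
  have hpO₁ : (p : ℤ) • O ≤ (p : ℤ) • O₁ := fun z hz => by
    obtain ⟨o, ho, rfl⟩ := (Submodule.mem_smul_pointwise_iff_exists _ _ O).mp hz
    exact Submodule.smul_mem_pointwise_smul _ _ O₁ (hle ho)
  set Q : Submodule ℤ B := P ⊓ O with hQ
  have hQP : Q ≤ P := inf_le_left
  have hQO : Q ≤ O := inf_le_right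
  -- `c N • z ∈ Q` for `z ∈ P`
  have hscale : ∀ {z : B}, z ∈ P → b • ((N : ℤ) • z) ∈ Q := fun hz =>
    ⟨P.smul_mem _ (P.smul_mem _ hz), O.smul_mem _ (natCast_smul_mem_of_relIndex hN (hup hz))⟩
  have hp1Q : (p : ℤ) • (1 : B) ∈ Q :=
    ⟨hlow (Submodule.smul_mem_pointwise_smul _ _ O₁ hO₁.one_mem),
      O.smul_mem _ hO.one_mem⟩
  have hpQ : ∀ {o : B}, o ∈ O → (p : ℤ) • o ∈ Q := fun ho =>
    ⟨hlow (hpO₁ (Submodule.smul_mem_pointwise_smul _ _ O ho)), O.smul_mem _ ho⟩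
  refine ⟨Q, fun x hx => ?_, hQO, ?_, ?_, le_antisymm ?_ ?_, ?_, ?_⟩
  · -- `p O ≤ Q`
    obtain ⟨o, ho, rfl⟩ := (Submodule.mem_smul_pointwise_iff_exists _ _ O).mp hx
    exact hpQ ho
  · rw [Submodule.mul_le]
    intro x hx q hq
    exact ⟨(Submodule.mul_le.mp hOP) x (hle hx) q (hQP hq), hO.mul_mem _ hx _ (hQO hq)⟩
  · rw [Submodule.mul_le]
    intro q hq x hx
    exact ⟨(Submodule.mul_le.mp hPO) q (hQP hq) x (hle hx), hO.mul_mem _ (hQO hq) _ hx⟩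
  · -- `Q Q ≤ p O`
    rw [Submodule.mul_le]
    intro x hx y hy
    refine key (hO.mul_mem _ (hQO hx) _ (hQO hy)) ?_
    rw [← hPP]
    exact Submodule.mul_mem_mul (hQP hx) (hQP hy)
  · -- `p O ≤ Q Q`
    have hsq : ∀ z ∈ P * P, (b * (N : ℤ)) ^ 2 • z ∈ Q * Q := fun z hz => by
      refine Submodule.mul_induction_on hz (fun x hx y hy => ?_) (fun x y hx hy => ?_)
      · have : (b * (N : ℤ)) ^ 2 • (x * y) = (b • ((N : ℤ) • x)) * (b • ((N : ℤ) • y)) := by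
          rw [smul_smul, smul_smul, smul_mul_smul_comm, pow_two]
        rw [this]
        exact Submodule.mul_mem_mul (hscale hx) (hscale hy)
      · rw [smul_add]; exact Submodule.add_mem _ hx hy
    intro x hx
    obtain ⟨o, ho, rfl⟩ := (Submodule.mem_smul_pointwise_iff_exists _ _ O).mp hx
    -- `(bN)² = 1 + p k`
    obtain ⟨k, hk⟩ : ∃ k : ℤ, (b * (N : ℤ)) ^ 2 = 1 + (p : ℤ) * k :=
      ⟨a * a * p - 2 * a, by
        have h : b * (N : ℤ) = 1 - a * p := by linear_combination hab
        rw [h]; ring⟩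
    have hmem : (b * (N : ℤ)) ^ 2 • ((p : ℤ) • o) ∈ Q * Q :=
      hsq _ (hPP ▸ hpO₁ (Submodule.smul_mem_pointwise_smul _ _ O ho))
    have : (b * (N : ℤ)) ^ 2 • ((p : ℤ) • o) - ((p : ℤ) • (1 : B)) * ((p : ℤ) • (k • o)) = (p : ℤ) • o := by
      rw [hk, smul_mul_smul_comm, one_mul, add_smul, one_smul, smul_smul, smul_smul]
      module
    rw [← this]
    exact Submodule.sub_mem _ hmem (Submodule.mul_mem_mul hp1Q (hpQ (O.smul_mem _ ho)))
  · -- the index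
    have hQ' : Q.toAddSubgroup = P.toAddSubgroup ⊓ O.toAddSubgroup := rfl
    set r := Q.toAddSubgroup.relIndex O.toAddSubgroup with hr
    have h1 : r * N = Q.toAddSubgroup.relIndex O₁.toAddSubgroup := by
      rw [hr, ← hN]
      exact AddSubgroup.relIndex_mul_relIndex _ _ _ (Submodule.toAddSubgroup_mono hQO)
        (Submodule.toAddSubgroup_mono hle)
    have h2 : O.toAddSubgroup.relIndex P.toAddSubgroup * p ^ 2 = Q.toAddSubgroup.relIndex O₁.toAddSubgroup := by
      rw [← hidx, hQ', ← AddSubgroup.inf_relIndex_left P.toAddSubgroup O.toAddSubgroup]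
      exact AddSubgroup.relIndex_mul_relIndex _ _ _ inf_le_left (Submodule.toAddSubgroup_mono hup)
    have h3 : O.toAddSubgroup.relIndex P.toAddSubgroup ≤ N := by
      rw [← hN]
      exact AddSubgroup.relIndex_le_of_le_right (Submodule.toAddSubgroup_mono hup) (by rw [hN]; exact hN0)
    have hr0 : r ≠ 0 := by
      have hdvd : r ∣ ((p : ℤ) • O).toAddSubgroup.relIndex O.toAddSubgroup :=
        AddSubgroup.relIndex_dvd_of_le_left _ (Submodule.toAddSubgroup_mono fun x hx => by
          obtain ⟨o, ho, rfl⟩ := (Submodule.mem_smul_pointwise_iff_exists _ _ O).mp hx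
          exact hpQ ho)
      rw [← hO.card_residue_eq_relIndex, hO.card_residue hp.ne_zero] at hdvd
      exact fun h0 => by rw [h0, zero_dvd_iff] at hdvd; exact pow_ne_zero 4 hp.ne_zero hdvd
    set s := O.toAddSubgroup.relIndex P.toAddSubgroup
    have hrs : r * N = s * p ^ 2 := h1.trans h2.symm
    have hNs : N ∣ s := by
      have hcop : N.Coprime (p ^ 2) := (Nat.Coprime.pow_right 2 hpN.symm)
      exact hcop.dvd_of_dvd_mul_right ⟨r, by rw [← hrs, mul_comm]⟩
    have hsN : s = N := by
      rcases Nat.eq_zero_or_pos s with hs0 | hspos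
      · exfalso
        rw [hs0, zero_mul, mul_eq_zero] at hrs
        exact hrs.elim hr0 hN0
      · exact le_antisymm h3 (Nat.le_of_dvd hspos hNs)
    rw [hsN, mul_comm] at hrs
    exact Nat.eq_of_mul_eq_mul_left (Nat.pos_of_ne_zero hN0) hrs
  · -- division
    intro x hx hxQ
    have hxP : x ∉ P := fun h => hxQ ⟨h, hx⟩
    obtain ⟨w₁, hw₁, h1, h2⟩ := hdiv x (hle hx) hxP
    obtain ⟨w, hw, hww⟩ := exists_mem_sub_mem_smul hN hpN hw₁
    refine ⟨w, hw, ⟨?_, O.sub_mem (hO.mul_mem _ hx _ hw) hO.one_mem⟩,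
      ⟨?_, O.sub_mem (hO.mul_mem _ hw _ hx) hO.one_mem⟩⟩
    · have : x * w - 1 = x * (w - w₁) + (x * w₁ - 1) := by noncomm_ring
      rw [this]
      exact P.add_mem (hlow (hO₁.mul_smul_mem (hle hx) hww)) h1
    · have : w * x - 1 = (w - w₁) * x + (w₁ * x - 1) := by noncomm_ring
      rw [this]
      exact P.add_mem (hlow (hO₁.smul_mul_mem hww (hle hx))) h2

end Transfer

/-- **An Eichler order is residually split or residually ramified at every prime not dividing
its level.** [cite: VignerasLNM800, Ch. II §§1–2 (Thm. 1.1, Thm. 2.3); Ch. III §5 Déf. (ordres d'Eichler)] -/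
theorem IsEichlerOrder.residuallySplit_or_ramified {O : Submodule ℤ B} {N p : ℕ}
    (hE : IsEichlerOrder O N) (hp : p.Prime) (hpN : p.Coprime N) :
    hE.isZOrder.IsResiduallySplit p ∨ hE.isZOrder.IsResiduallyRamified p := by
  obtain ⟨O₁, O₂, h₁, h₂, hO, hN⟩ := hE
  have hle : O ≤ O₁ := hO ▸ inf_le_left
  rcases h₁.residuallySplit_or_ramified h₁.1 hp with h | h
  · exact Or.inl (IsZOrder.IsResiduallySplit.of_le _ h₁.1 hle hN hpN h)
  · exact Or.inr (IsZOrder.IsResiduallyRamified.of_le _ h₁.1 hle hN hpN hp h)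

end Literature.NumberTheory.Automorphic

end
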